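import Mathlib
import HarnessLib
import HarnessLib.Audit
import Summits.KontsevichZagierPeriods.Statement

/-!
Route: TerasomaCovering

CLOSED (retired) 2026-08-15T13:48:37Z by operator:999:1257524 — reason: not-a-thesis: assembly does not conclude the sub-problem Statement — note: D-0027 §2.1 audit (human 2026-08-15: routes that do not decide the summit are removed): the assembly concludes `TriplicationAccessible`, not the sub-problem statement; a NEW conforming route may be opened from the same idea (generated `closes : … → _root_.KontsevichZagierPeriods`).. The file is kept as the record of this route; refuted decls are indexed as negative knowledge (`ledger negatives`).

# Route TerasomaCovering — Multiplication is a move — Terasoma's covering transposes Euler–Gauss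
multiplication into the KZ rules

SECTOR ROUTE realising card terasoma-covering-gauss-multiplication (no claim on the summit; see
Assembly). X (MULTIPLICATION IS A
MOVE): for every n ≥ 2 and every rational s > 0, Euler's pure-Beta form of the Gauss multiplication
formula,
∏_{k=1}^{n−1} B(k/n, s) = n^{ns−1}·Γ(s)^n/Γ(ns) [E421 §53, via arXiv:1901.03400], read as the pair
of (n−1)-dimensional algebraic
KZ representations (box rep ∫_{(0,1)^{n−1}} ∏_k v_k^{k/n−1}(1−v_k)^{s−1} dv | simplex rep ∫_{σ_j>0,
Σσ_j=n} (∏_{j=1}^{n} σ_j)^{s−1} dσ —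
the two sides of Terasoma's common covering X → T ← C^{n−1}), is a KZ-equivalence. n = 2 is the t =
4x(1−x) duplication chain
(LowDimension 0118, all s here); n = 3 is the first case where Terasoma's map has complex
coefficients and the content is a
BETTI transposition (rank-2 crux); with Dirichlet re-association and dimension-1 reflections it
yields the tree's test pair
Neg 0312 = TriplicationAccessible (rank-3 crux), i.e. refutes Neg's bet 0311 at pressure point (b)
"Γ-detours".
Lean: `∀ (m : ℕ) (s : ℚ), 1 ≤ m → 0 < s → ∀ (r r' :
Literature.NumberTheory.Transcendental.KZ.IntegralRep m), r.domain = {x | ∀ i, x i ∈ Set.Ioo (0:ℝ)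
1} → Set.EqOn r.integrand (fun x => ∏ i : Fin m, (x i) ^ ((((i:ℕ):ℝ) + 1) / ((m:ℝ) + 1) - 1) * (1 -
x i) ^ ((s:ℝ) - 1)) r.domain → r'.domain = {x | (∀ i, 0 < x i) ∧ ∑ i, x i < (m:ℝ) + 1} → Set.EqOn
r'.integrand (fun x => ((∏ i, x i) * ((m:ℝ) + 1 - ∑ i, x i)) ^ ((s:ℝ) - 1)) r'.domain →
Literature.NumberTheory.Transcendental.KZ.Equivalent r r'`

## Assembly
Pure logic (modus ponens; `example : Assembly := fun h g => g h` in Sketch.lean): the rank-2 crux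
and the glue give the tree's test
item 0312. Deliberately NOT `… → KontsevichZagierPeriods`: this is a sector route; its summit-ward
content is (i) 0312 proved ⇒ Neg 0311
refuted (route Neg broken at pressure point (b)), ExpConservative 0544 follows by inclusion; (ii)
MultiplicationAccessible is the missing
generator of the Fermat sector (support FermatSectorReduction, filed informally after open: with
translation/reflection and Dirichlet
re-association every STANDARD relation among Beta products becomes a chain, so Conjecture 1 on pairs
of Beta-monomial reps reduces to
the named transcendence statement of Rohrlich–Lang plus the Das/Yamamoto 2-torsion identities — the
successor test shared with cards
integral-domain-roots-of-identities and lefschetz-inversion-is-free).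

Rationale: WHY THIS LINE. Terasoma's diagram (Terasoma1995; Otsubo2023 App. = arXiv:2108.06754 pp. 21–22 read;
OtsuboYamazaki2026 Thm 7.2 = arXiv:2402.06072
pp. 19–20 read) over S = {Σ_{j≤n} s_j = n, ∏ s_j ≠ 0}: Kummer cover T: t^d = ∏ s_j, twisted Fermat
X: Σ t_j^d = n → T, and
q : C^{n−1} → T, C : x^d + y^n = 1 (x ≠ 0), s_j = ∏_i (1 − ζ_n^j y_i), t = ∏ x_i. PLANNER'S
COMPUTATION (checked n = 2, 3): with
ω_T := t^a ds_1…ds_{n−1}/(s_1⋯s_n), a = ds, the Jacobian det(∂s_j/∂y_i) is a Cauchy determinant and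
every s_j cancels, so
q^*ω_T = c_n·∏_i x_i^{a−d}·∏_{i<i'}(y_i − y_{i'}) dy = (c_n/n^{n−1}) Σ_σ sgn σ ⊠_i ω_{σ(i)}, ω_k :=
n x^{a−d} y^{k−1} dy, ∫_0^1 ω_k =
B(k/n, s), c_n cyclotomic (c_2 = 1, c_3 = i√3): the de Rham ("eigenform") comparison flagged by the
card's triage is an IDENTITY
OF ALGEBRAIC FORMS — no exact correction, no projector, no division by |G|. The simplex rep IS ∫ ω_T
over the positive real
sheet of T; over it every sheet Z_0 of q has the same period. All remaining content is Betti: Z_0 ⊂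
C^{n−1}(ℂ) is NOT a
product of real arcs for n ≥ 3 (the y_i are the inverse roots of the degree-(n−1) polynomial with
prescribed positive values
at the n-th roots of unity), and ∫_{γ^{n−1}} q^*ω_T = 0 by antisymmetry; one needs the INTEGRAL
group-ring relation [Z_0] =
Θ_n·[γ^{n−1}] + ∂W_n, Θ_n ∈ ℤ[(μ_d×μ_n)^{n−1} ⋊ S_{n−1}] (expected from cyclicity of H_1 of the open
Fermat-type curve relative
to its cusps over the group ring, generated by the real arc γ — Rohrlich's appendix to Gross1978 for
F_N), realised by an
explicit semialgebraic real n-chain W_n avoiding {y_i = ∞} (ω_k is not integrable there). Inside the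
H21 calculus: Stokes over
W_n for the closed algebraic form ⊠ω = Newton–Leibniz moves whose primitives are the form's own
(algebraic) coefficients, in
one extra variable; sheets = changeOfVariablesRel on injectivity cells; roots of unity = pairs (Re,
Im) of real reps with
algebraic cos/sin constants (tree: KZSemialgebraicComplex.lean); group translates g·γ^{n−1} = box
reps. For n = 2 (ζ = −1) q
is real, Z_0 = γ − η_*γ exactly (η : y ↦ −y), Θ_2 = 1 − η, W_2 = ∅, and the chain is the classical
4-move duplication proof —
calibration passed on paper. Imported areas: Chow/Fermat motives and the finite-field dictionary
(Davenport–Hasse counted on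
the same diagram, Otsubo2023 App.; Weil) as the litmus that the moves are "elementary"; topology of
Fermat curves (Gross1978
appendix) for Θ_n; classical analysis says why this is needed: every printed proof of multiplication
for n ≥ 3 leaves the
algebraic class (AndrewsAskeyRoy1999 §1.5 read: Pochhammer + reflection + limit, Stirling, or
Liouville's e^{−t} multiple
integral with dI/dz = −mI; Euler's own E421 argument interpolates from integers). Versus the other
0312 cards (riemann-bilinear
TRI: a CM isogeny "to be made explicit"; two-route-hypergeometric: Goursat cubic; selberg-amgm:
carries a ℤ/3 torsion): this
is the only correspondence printed end to end, and it proves the whole multiplication family at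
once.

RANKED CRUXES. #0 MultiplicationAccessible (target) — X of § Thesis: for every m ≥ 1 (n = m+1) and
rational s > 0 the box rep of ∏_{k=1}^{m} B(k/n, s) and the simplex rep ∫_{Σσ=n}(∏σ_j)^{s−1} (value
n^{ns−1}Γ(s)^n/Γ(ns); equal by Euler–Gauss, checked numerically n = 2..5) are KZ-equivalent. (why it
might fail: for n ≥ 3 the Terasoma cycle may not be an INTEGRAL group-ring translate of γ^{n−1}
modulo boundaries avoiding y = ∞ (only N·([r]−[r']) ∈ relations, and FormalRep/relations may have
torsion); W_n may have to depend on s.) [Terasoma1995, OtsuboYamazaki2026, Otsubo2023, Gross1978,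
arXiv:1901.03400, KontsevichZagier2001]
#2 MultiplicationThree (crux) — n = 3, all rational s > 0: [∫∫_{(0,1)²} v_1^{−2/3}(1−v_1)^{s−1}
v_2^{−1/3}(1−v_2)^{s−1}] ~ [∫∫_{σ_1,σ_2>0, σ_1+σ_2<3} (σ_1σ_2(3−σ_1−σ_2))^{s−1}] (B(1/3,s)B(2/3,s) =
3^{3s−1}Γ(s)³/Γ(3s), e.g. 111.09287484 at s = 1/9). First non-real case of Terasoma's map (c_3 =
i√3): exhibit Θ_3 ∈ ℤ[(μ_d×μ_3)² ⋊ S_2] and a semialgebraic 3-chain W_3 ⊂ C²(ℂ) ⊂ ℝ⁸ with ∂W_3 = Z_0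
− Θ_3·γ² (mod chains on which (x_1x_2)^{a−d}(y_2−y_1)dy_1dy_2 restricts to 0), then Stokes = three
Newton–Leibniz moves with the form's coefficients as primitives, sheets as CoV, ζ_3-twists as (Re,
Im) pairs. [difficulty: L] (why it might fail: the 2-cycle Z_0 (pairs of inverse roots with positive
values at cube roots of 1) may be ℤ[G]-homologous to γ² only through {y = ∞}, where ω_2 has a
non-integrable pole, or only N·Z_0 may be (torsion in FormalRep/relations); a uniform-in-s chain may
not exist.) [Terasoma1995, OtsuboYamazaki2026, Otsubo2023, Gross1978, Deligne1982HodgeCycles,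
KontsevichZagier2001]
#3 TriplicationAccessible (crux) — the tree's Gauss-triplication test pair (verbatim
stmt-KontsevichZagierPeriods-0312 = Neg.TriplicationAccessible = ExpConservative 0544 without Γ):
[(0,1)², x^{−8/9}(1−x)^{−5/9}y^{−4/9}(1−y)^{−2/9}] ~ [{x²+y²<4}, 3^{7/6}/2] (B(1/9,4/9)B(5/9,7/9) =
2·3^{7/6}π = 22.6371282948). Reached from MultiplicationThree at s = 1/9 by Dirichlet re-association
CoVs (u,v) ↦ (uv,(1−u)v), translation = Newton–Leibniz with the algebraic primitive x^s(1−x)^t, and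
the dimension-1 reflections B(1/3,2/3) = 2π/√3, B(1/9,8/9) = π/sin(π/9) (LowDimension 0405
territory); or directly. [deps: MultiplicationThree] [difficulty: L] (why it might fail: Neg's bet
0311 (an additive invariant finer than Hodge data separating the pair); even given
MultiplicationThree, the dimension-1 reflection values at 1/9 need the completeness of dimension ≤ 1
(LowDimension 0405, open) and tensoring chains with fixed reps (KZProduct mul_mem_relations,
unproved).) [Deligne1982HodgeCycles, KontsevichZagier2001, Waldschmidt2006, OtsuboYamazaki2026,
Aoki1987]
#9 DuplicationAllExponents (support) — n = 2 calibration for all rational s > 0 (generalises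
LowDimension 0118, which is s = 1/3 in another normalisation): [∫_0^1 v^{−1/2}(1−v)^{s−1} dv] ~
[∫_0^2 (σ(2−σ))^{s−1} dσ] (B(1/2,s) = 2^{2s−1}B(s,s)). Terasoma's map is real: CoV σ = 1+y, domain
additivity at y = 0 plus CoV y ↦ −y (Θ_2 = 1 − η), CoV v = y²: four moves; exercises the
changeOfVariablesRel side conditions (InjOn, HasFDerivWithinAt, IsSemialgebraicMapOn) every other
item needs. [difficulty: provable-now] [KontsevichZagier2001, AndrewsAskeyRoy1999, arXiv:1901.03400]
#9 TriplicationGlue (support) — the glue from the n = 3 multiplication chain to the literal 0312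
pair: specialise MultiplicationThree at s = 1/9, re-associate Beta products by Dirichlet CoVs (both
sides become Γ(1/9)Γ(4/9)Γ(7/9)-shaped box reps), translate Γ(4/3) = Γ(1/3)/3 by one Newton–Leibniz
move with algebraic primitive, and discharge the two reflection values B(1/3,2/3) = 2π/√3 (= 3∫_0^∞
dw/(1+w³)) and B(1/9,8/9) = π/sin(π/9) by dimension-1 moves; products of chains with fixed reps via
KZProduct (IntegralRep.prod). Provable modulo those dimension-1 identities, which the prover may
take from LowDimension 0405 or do by hand. [difficulty: M] [KontsevichZagier2001,
AndrewsAskeyRoy1999, Waldschmidt2006]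

TWO-LAYER PLAN. Foreseen once MultiplicationThree is claimed/stalls: MultiplicationThree ⇐
FibrewisePeriodRelation → BaseIntegration → MultiplicationThree,
fibring both sides over c = t^d = ∏σ_j = ∏(1−v_k) (T → 𝔾_m): fibrewise, a real-period relation
between the Hesse-type cubic
{Σσ = 3, ∏σ = c} and the C-side fibre {∏ x_i^d = c} induced by Terasoma's q at fixed c (a
correspondence of genus-1 curves over
ℚ(ζ_3, c)), then one Newton–Leibniz/Fubini glue in c. MultiplicationAccessible ⇐
MultiplicationThree-pattern for n → BettiCyclicity
(informal crux, filed after open) → all n. TriplicationAccessible ⇐ MultiplicationThree →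
TriplicationGlue (already the assembly).

KILL CRITERIA. Refutation of MultiplicationThree or of TriplicationAccessible (an additive invariant
of FormalRep vanishing on the four move sets and
separating a multiplication pair — Neg 0313 shape) closes the route `refuted:<Decl>` AND is the
tree's headline event (the H21 calculus is
strictly weaker than Chow-motivic relations realised by finite correspondences); the witness would
say which step is not a move
(Stokes through y = ∞? torsion?). A proof that [Z_0] ∉ ℤ[G]·[γ²] in H_2 relative to integrable
boundary forces the pivot to the
fibrewise plan or to N·(pair) statements. TriplicationAccessible proved by another card's mechanism
(TRI isogeny, Goursat cubic) moots
crux 3 only; the multiplication family (target, crux 2) stands.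

NOT DECOMPOSED YET. The general-n chain (Θ_n, W_n) beyond n = 3; "Stokes on a semialgebraic 3-chain
is three Newton–Leibniz moves" and "finite maps act
by CoV on injectivity cells" (tool lemmas, attached by provers with --supports, shared with card
correspondences-as-multivalued-cov);
the dimension-1 reflection identities inside TriplicationGlue (LowDimension's line); the
Fermat-sector reduction (Rohrlich–Lang,
Das 2-torsion) — informal support only; d-dependence (none expected: W lives in y-space, x follows
by continuation).

CHEAPEST FALSIFIER. (1) Compute H_2 of (C⁺)² relative to the cusp divisors for d = 9, n = 3 as a
ℤ[(μ_9×μ_3)² ⋊ S_2]-module (finite CW model of the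
Fermat quotient curve; a kit job) and test whether the class of Z_0 lies in the span of
[γ²]-translates with boundary avoiding
y = ∞ — if not, crux 2 as planned is dead. (2) Cheaper still, done here: n = 2 must reproduce the
known 4-move duplication chain —
it does (Θ_2 = 1 − η, W_2 = ∅). (3) Numerics done here: both sides agree for n = 2..5, s ∈ {1/9,
2/7, 5/3} (math.gamma, 1e-13).

NUMBERS. B(1/3,s)B(2/3,s) = 3^{3s−1}Γ(s)³/Γ(3s): 111.0928748424 (s = 1/9), 24.1402508051 (2/7),
2.4829585812 (5/3). 0312: 22.6371282948 both
sides. c_2 = 1, c_3 = i√3 (Jacobian constants). |Gal(C^{n−1}/S)| = d^{n−1}(n−1)!; sheets over the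
positive simplex with ∏x_i > 0:
d^{n−2}(n−1)!. Items at open: 6 (target 1, crux 2, support 2, assembly 1); to be added informally:
crux BettiCyclicity (rank 4),
support FermatSectorReduction.

DEFINITION REQUESTS. None needed for the typed items (KZ.IntegralRep, KZ.Equivalent, KZProduct
exist). Facts wanted later (cite items, not filed now):
Rohrlich's cyclicity of H_1(F_N, cusps; ℤ) over ℤ[μ_N²] (Gross1978 appendix); OtsuboYamazaki2026 Thm
7.2; Deligne1982HodgeCycles
Thm 7.15. Acquisition filed: Terasoma1995 (acq-02267).

Novelty: Searches (2026-08-15; local searchd DOWN — connection reset; OpenAlex/S2/arXiv rate-limited): `lit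
search --source crossref "Terasoma
multiplication formula hypergeometric functions"` (8: Terasoma 1992/93/96/97,
Asakura–Otsubo–Terasoma doi:10.1017/nmj.2018.36);
`--source zbmath` same (2: zbl:0873.14011 = Terasoma1995, proceedings zbl:0838.00011); `lit galaxy
search "multiplication formula for
hypergeometric functions Terasoma" --star all` (0); `lit search --source crossref "elementary proof
Gauss multiplication formula gamma
function beta integrals"` (6: Beebee1994 doi:10.2307/2160219 covering systems, Aycock
arXiv:1901.03400 READ — Euler E421 §53 states
the pure-Beta form, proofs "not completely convincing", E321 verifies low classes; MacRobert1959;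
Stolarsky1991); `--source zbmath
"multiplication theorem gamma function elementary proof"` (8, none relevant); `"Fermat curve
homology cusps cyclic module Rohrlich"`
(0); `lit frontier KontsevichZagierPeriods --since 2020` (30; nearest arXiv:2303.05030 GPC for CM
Kummer surfaces); `lit bridges
--cross any` (30, none on multiplication); held texts READ: arXiv:2108.06754 pp. 21–22,
arXiv:2402.06072 pp. 19–20 (Thm 7.2, Rem 7.4:
periods only "up to ℚ(ζ_d)^*"), AndrewsAskeyRoy1999 §1.5 pp. 22–24.
Nearest prior art found: OtsuboYamazaki2026 Thm 7.2 / Rem 7.4 (multiplication formula = iso of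
invertible Chow motives, periods up to
ℚ(ζ_d)^*); Terasoma1995 (cohomological proof on the common covering); Euler E421 §53 via
arXiv:1901.03400 (t  [refs: 10.1017/nmj.2018.36, 10.2307/2160219, 1901.03400, 2303.05030, 2108.06754, 2402.06072, doi:10.1017/nmj.2018.36, doi:10.2307/2160219, Terasoma1995, AndrewsAskeyRoy1999, OtsuboYamazaki2026]

Barriers (technique_class: correspondence-transfer fermat-motives betti-transposition): - technique_class: correspondence-transfer fermat-motives betti-transposition
- Literature.Barriers.KontsevichZagierPeriods.noSemialgebraicPrimitive_inv_sub_two: evaded by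
construction — Newton–Leibniz is used only with ALGEBRAIC primitives (the coefficients of the closed
algebraic form ⊠ω_k along W_n, and x^s(1−x)^t for translations); no variable is integrated out with
a transcendental primitive, and the number of variables is not fixed (the n = 3 chain passes through
3-dimensional reps: the barrier's own "add variables" evasion).
- Literature.Barriers.KontsevichZagierPeriods.kzConjecture_implies_oddZetaAlgIndep: not engaged —
sector route proving KNOWN equalities (Euler–Gauss multiplication) inside the rules; no
independence/transcendence statement is claimed or implied.
- Literature.Barriers.KontsevichZagierPeriods.kzConjecture_implies_twoPiI_log_algIndep: not engaged,
same reason; the dimension-1 reflections used in TriplicationGlue are explicit identities, not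
Baker-type independence.
- Literature.Barriers.KontsevichZagierPeriods.kzConjecture_implies_ellipticPeriods_algIndep: not
engaged, same reason (the fibrewise plan meets genus-1 pencils only through explicit correspondences
at algebraic fibres).
- Literature.Barriers.KontsevichZagierPeriods.cressonViuSos_prop_3_2: not engaged — the chain
dissects (domain additivity over sheets/injectivity cells and Stokes cells); no single global
semialgebraic homeomorphism between the two representations is sought.
- Literature.Bar

History (route lifecycle, newest last):
- 2026-08-15T13:48:37Z · CLOSED retired — not-a-thesis: assembly does not conclude the sub-problem Statement (operator:999:1257524)

sub-problem: KontsevichZagierPeriods · status: closed(retired) · opened planner-plancard-KontsevichZagierPeriods-Kont-ff3d1b52-0 2026-08-15T11:20:58Z · rev 1 · ledger route-KontsevichZagierPeriods-TerasomaCovering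
GENERATED by the gate from the ledger (D-0016/17). Provers cite these decls: `theorem foo : Summit.KontsevichZagierPeriods.KontsevichZagierPeriods.Theses.TerasomaCovering.<Decl> := …` in Summits/KontsevichZagierPeriods/KontsevichZagierPeriods/Theorems/<Name>.lean.
-/

namespace Summit.KontsevichZagierPeriods.KontsevichZagierPeriods.Theses.TerasomaCovering

open scoped BigOperators Topology Manifold Classical MeasureTheory ProbabilityTheory Matrix InnerProductSpace ComplexConjugate ContinuousMap
open Filter Set Function TopologicalSpace MeasureTheory

attribute [summit_statement] _root_.KontsevichZagierPeriods

open Literature Periods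

/-- item stmt-KontsevichZagierPeriods-3597 · target · rank 0 · closed · moot by None · by planner
why it might fail: for n ≥ 3 the Terasoma cycle may not be an INTEGRAL group-ring translate of γ^{n−1} modulo boundaries avoiding y = ∞ (only N·([r]−[r']) ∈ relations, and FormalRep/relations may have torsion); W_n may have to depend on s.
sources: Terasoma1995, OtsuboYamazaki2026, Otsubo2023, Gross1978, arXiv:1901.03400, KontsevichZagier2001
[target] X of § Thesis: for every m ≥ 1 (n = m+1) and rational s > 0 the box rep of ∏_{k=1}^{m}
B(k/n, s) and the simplex rep ∫_{Σσ=n}(∏σ_j)^{s−1} (value n^{ns−1}Γ(s)^n/Γ(ns); equal by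
Euler–Gauss, checked numerically n = 2..5) are KZ-equivalent. -/
@[route_item "route-KontsevichZagierPeriods-TerasomaCovering"]
def MultiplicationAccessible : Prop :=
  ∀ (m : ℕ) (s : ℚ), 1 ≤ m → 0 < s → ∀ (r r' : Literature.NumberTheory.Transcendental.KZ.IntegralRep m), r.domain = {x | ∀ i, x i ∈ Set.Ioo (0:ℝ) 1} → Set.EqOn r.integrand (fun x => ∏ i : Fin m, (x i) ^ ((((i:ℕ):ℝ) + 1) / ((m:ℝ) + 1) - 1) * (1 - x i) ^ ((s:ℝ) - 1)) r.domain → r'.domain = {x | (∀ i, 0 < x i) ∧ ∑ i, x i < (m:ℝ) + 1} → Set.EqOn r'.integrand (fun x => ((∏ i, x i) * ((m:ℝ) + 1 - ∑ i, x i)) ^ ((s:ℝ) - 1)) r'.domain → Literature.NumberTheory.Transcendental.KZ.Equivalent r r'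

/-- item stmt-KontsevichZagierPeriods-3598 · crux · rank 2 · open · by planner
why it might fail: the 2-cycle Z_0 (pairs of inverse roots with positive values at cube roots of 1) may be ℤ[G]-homologous to γ² only through {y = ∞}, where ω_2 has a non-integrable pole, or only N·Z_0 may be (torsion in FormalRep/relations); a uniform-in-s chain may not exist.
sources: Terasoma1995, OtsuboYamazaki2026, Otsubo2023, Gross1978, Deligne1982HodgeCycles, KontsevichZagier2001
[crux] n = 3, all rational s > 0: [∫∫_{(0,1)²} v_1^{−2/3}(1−v_1)^{s−1} v_2^{−1/3}(1−v_2)^{s−1}] ~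
[∫∫_{σ_1,σ_2>0, σ_1+σ_2<3} (σ_1σ_2(3−σ_1−σ_2))^{s−1}] (B(1/3,s)B(2/3,s) = 3^{3s−1}Γ(s)³/Γ(3s), e.g.
111.09287484 at s = 1/9). First non-real case of Terasoma's map (c_3 = i√3): exhibit Θ_3 ∈
ℤ[(μ_d×μ_3)² ⋊ S_2] and a semialgebraic 3-chain W_3 ⊂ C²(ℂ) ⊂ ℝ⁸ with ∂W_3 = Z_0 − Θ_3·γ² (mod
chains on which (x_1x_2)^{a−d}(y_2−y_1)dy_1dy_2 restricts to 0), then Stokes = three Newton–Leibniz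
moves with the form's coefficients as primitives, sheets as CoV, ζ_3-twists as (Re, Im) pairs.
[difficulty: L] -/
@[route_item "route-KontsevichZagierPeriods-TerasomaCovering"]
def MultiplicationThree : Prop :=
  ∀ s : ℚ, 0 < s → ∀ (r r' : Literature.NumberTheory.Transcendental.KZ.IntegralRep 2), r.domain = {x | ∀ i, x i ∈ Set.Ioo (0:ℝ) 1} → Set.EqOn r.integrand (fun x => (x 0) ^ (-(2:ℝ)/3) * (1 - x 0) ^ ((s:ℝ) - 1) * (x 1) ^ (-(1:ℝ)/3) * (1 - x 1) ^ ((s:ℝ) - 1)) r.domain → r'.domain = {x | 0 < x 0 ∧ 0 < x 1 ∧ x 0 + x 1 < 3} → Set.EqOn r'.integrand (fun x => (x 0 * x 1 * (3 - x 0 - x 1)) ^ ((s:ℝ) - 1)) r'.domain → Literature.NumberTheory.Transcendental.KZ.Equivalent r r'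

/-- item stmt-KontsevichZagierPeriods-0312 · crux · rank 3 · open · by planner
why it might fail: Neg's bet 0311 (an additive invariant finer than Hodge data separating the pair); even given MultiplicationThree, the dimension-1 reflection values at 1/9 need the completeness of dimension ≤ 1 (LowDimension 0405, open) and tensoring chains with fixed reps (KZProduct mul_mem_relations, unproved).
sources: Deligne1982HodgeCycles, KontsevichZagier2001, Waldschmidt2006, OtsuboYamazaki2026, Aoki1987
Positive form of #2. A proof must avoid Γ: candidate strategy = realise the degree-9 Fermat-curve
correspondence behind the identity as semialgebraic changes of variables between (blow-ups of)
(0,1)² pieces plus Newton–Leibniz with algebraic primitives (Rohrlich/Deligne distribution relations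
are induced by the maps x ↦ x³ on Fermat curves — algebraic, finite ⇒ CoV on injectivity cells). If
found, pressure point (b) of route Neg dies at its first instance. [elaborates: yes:
_survey/SketchB.lean; sources: Deligne1982HodgeCycles, KontsevichZagier2001] -/
@[route_item "route-KontsevichZagierPeriods-TerasomaCovering"]
def TriplicationAccessible : Prop :=
  ∀ (r r' : Literature.NumberTheory.Transcendental.KZ.IntegralRep 2), r.domain = {x | ∀ i, x i ∈ Set.Ioo (0:ℝ) 1} → Set.EqOn r.integrand (fun x => (x 0) ^ (-(8:ℝ)/9) * (1 - x 0) ^ (-(5:ℝ)/9) * (x 1) ^ (-(4:ℝ)/9) * (1 - x 1) ^ (-(2:ℝ)/9)) r.domain → r'.domain = {x | x 0 ^ 2 + x 1 ^ 2 < 4} → Set.EqOn r'.integrand (fun _ => (3:ℝ) ^ ((7:ℝ)/6) / 2) r'.domain → Literature.NumberTheory.Transcendental.KZ.Equivalent r r'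

-- item stmt-KontsevichZagierPeriods-3664 · crux · rank 4 · closed · moot by None · by planner — informal only, no Lean statement yet:
--   [crux] BETTI INPUT FOR ALL n (informal; not typable: no singular homology of semialgebraic sets /
--   group-ring module structure in the tree). Let C⁺ = {x^d + y^n = 1} ⊂ 𝔸² (affine, x = 0 allowed), D =
--   {y = 0} ∪ {x = 0} its cusp divisor, G₀ = μ_d × μ_n, γ the real arc x, y ∈ (0,1). (i) H₁(C⁺(ℂ), D; ℤ)
--   is a cyclic ℤ[G₀]-module generated by [γ] (Rohrlich-type statement; for the Fermat curve F_N see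
--   Rohrlich's appendix to Gross1978); (ii) consequently H_{n−1}((C⁺)^{n−1}, boundary; ℤ) = H₁^{⊗(n−1)}
--   is cyclic over ℤ[G₀^{n−1}] generated by [γ^{n−1}], and the class of the Terasoma cycle Z₀ = closure
--   of

/-- item stmt-KontsevichZagierPeriods-3599 · support · rank 9 · closed · moot by None · by planner
sources: KontsevichZagier2001, AndrewsAskeyRoy1999, arXiv:1901.03400
[support] n = 2 calibration for all rational s > 0 (generalises LowDimension 0118, which is s = 1/3
in another normalisation): [∫_0^1 v^{−1/2}(1−v)^{s−1} dv] ~ [∫_0^2 (σ(2−σ))^{s−1} dσ] (B(1/2,s) =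
2^{2s−1}B(s,s)). Terasoma's map is real: CoV σ = 1+y, domain additivity at y = 0 plus CoV y ↦ −y
(Θ_2 = 1 − η), CoV v = y²: four moves; exercises the changeOfVariablesRel side conditions (InjOn,
HasFDerivWithinAt, IsSemialgebraicMapOn) every other item needs. [difficulty: provable-now] -/
@[route_item "route-KontsevichZagierPeriods-TerasomaCovering"]
def DuplicationAllExponents : Prop :=
  ∀ s : ℚ, 0 < s → ∀ (r r' : Literature.NumberTheory.Transcendental.KZ.IntegralRep 1), r.domain = {x | x 0 ∈ Set.Ioo (0:ℝ) 1} → Set.EqOn r.integrand (fun x => (x 0) ^ (-(1:ℝ)/2) * (1 - x 0) ^ ((s:ℝ) - 1)) r.domain → r'.domain = {x | x 0 ∈ Set.Ioo (0:ℝ) 2} → Set.EqOn r'.integrand (fun x => (x 0 * (2 - x 0)) ^ ((s:ℝ) - 1)) r'.domain → Literature.NumberTheory.Transcendental.KZ.Equivalent r r'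

/-- item stmt-KontsevichZagierPeriods-3600 · support · rank 9 · closed · moot by None · by planner
sources: KontsevichZagier2001, AndrewsAskeyRoy1999, Waldschmidt2006
[support] the glue from the n = 3 multiplication chain to the literal 0312 pair: specialise
MultiplicationThree at s = 1/9, re-associate Beta products by Dirichlet CoVs (both sides become
Γ(1/9)Γ(4/9)Γ(7/9)-shaped box reps), translate Γ(4/3) = Γ(1/3)/3 by one Newton–Leibniz move with
algebraic primitive, and discharge the two reflection values B(1/3,2/3) = 2π/√3 (= 3∫_0^∞ dw/(1+w³))
and B(1/9,8/9) = π/sin(π/9) by dimension-1 moves; products of chains with fixed reps via KZProduct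
(IntegralRep.prod). Provable modulo those dimension-1 identities, which the prover may take from
LowDimension 0405 or do by hand. [difficulty: M] -/
@[route_item "route-KontsevichZagierPeriods-TerasomaCovering"]
def TriplicationGlue : Prop :=
  MultiplicationThree → TriplicationAccessible

-- item stmt-KontsevichZagierPeriods-3683 · support · rank 9 · closed · moot by None · by planner — informal only, no Lean statement yet:
--   [support] FERMAT-SECTOR REDUCTION (informal; the route's summit-ward bookkeeping, deliberately not
--   decomposed). Sector = pairs of KZ representations that are real-algebraic multiples of products of
--   Beta values B(a_i,b_i), a_i,b_i in Q_{>0}, and of pi-reps (periods of Fermat curves). CLAIM: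
--   MultiplicationAccessible (all n) + translation (Newton-Leibniz with the algebraic primitive
--   x^a(1-x)^b: B(a+1,b) = a/(a+b) B(a,b)) + Dirichlet re-association ((u,v) -> (uv,(1-u)v):
--   B(a,b)B(a+b,c) = B(b,c)B(a,b+c), one 2-dim CoV) + the dimension-1 reflections B(a,1-a) = pi/sin(pi
--   a) (LowDimension 0405 territo

/-- item stmt-KontsevichZagierPeriods-3601 · assembly · rank 1 · closed · moot by None · by planner
sources: KontsevichZagier2001, Deligne1982HodgeCycles
[assembly] MultiplicationThree → TriplicationGlue → TriplicationAccessible. -/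
@[route_item "route-KontsevichZagierPeriods-TerasomaCovering"]
def Assembly : Prop :=
  MultiplicationThree → TriplicationGlue → TriplicationAccessible

end Summit.KontsevichZagierPeriods.KontsevichZagierPeriods.Theses.TerasomaCovering
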